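import Mathlib.Analysis.Fourier.FourierTransformDeriv
import Mathlib.Analysis.Distribution.SchwartzSpace.Fourier
import Mathlib.Analysis.Calculus.ContDiff.Bounds
import Literature.Analysis.FluidPDE.TaoAveragedEuler
import Literature.Analysis.FunctionSpaces.PlancherelL1L2
import Literature.Analysis.FunctionSpaces.TorusTrigPoly
import HarnessLib

/-!
# Smoothness and `L²` derivatives of the Euler bilinear operator on Schwartz fields

Proof file (second sibling of `TaoAveragedEuler.lean`, next to `TaoAveragedEulerProofs.lean`)
discharging the named fact `Literature.Analysis.FluidPDE.contDiff_eulerBilinear` of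
`Literature/Analysis/FluidPDE/TaoAveragedEuler.lean`: for Schwartz vector fields `u v` on
`ℝ^ι = EuclideanSpace ℝ ι`, the (function-level) Euler bilinear operator
`B(u,v) = -½ P[(u·∇)v + (v·∇)u]` (T. Tao, *Finite time blowup for an averaged
three-dimensional Navier–Stokes equation*, J. Amer. Math. Soc. 29 (2016), §1.1, the display
after (1.8): "`B(u,v)` takes values in `L²(ℝ³)` … when `u, v ∈ H¹⁰_df(ℝ³)`") is `C^∞` and all
its derivatives are square integrable.

## Proof

`w = (u·∇)v + (v·∇)u` is a Schwartz field (Mathlib `SchwartzMap.pairing`,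
`SchwartzMap.fderivCLM`), hence so is `ŵ` (`SchwartzMap.fourierTransformCLM`). The Leray symbol
is bounded, `‖P̂(ξ) c‖ ≤ 2‖c‖` (Cauchy–Schwarz), so `g = P̂ ŵ` is measurable, bounded and
rapidly decreasing, in particular `‖ξ‖ⁿ g ∈ L¹` for all `n` and `g ∈ L¹ ∩ L²`. Then
`P w = Re 𝓕⁻ g = Re 𝓕 (g ∘ neg)` is smooth (Mathlib `Real.contDiff_fourier`), its `n`-th
derivative is the Fourier integral of `(-2πi)ⁿ (ξ·)ⁿ g` (Mathlib `Real.iteratedFDeriv_fourier`),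
whose values on tuples of standard basis vectors are Fourier integrals of `L¹ ∩ L²` functions,
hence in `L²` by Plancherel (`Literature.Analysis.FunctionSpaces.memLp_two_fourierIntegral`);
the operator norm of a multilinear map on `ℝ^ι` is at most the sum of the norms of these values.
The result holds for every finite index type `ι` (for empty `ι`, `ℝ^ι` is a point).

Helpers live in the sub-namespace `ContDiffEuler`; the file adds only theorems (no
definitions): the complexified Schwartz field is Mathlib's `SchwartzMap.postcompCLM` of the
accepted isometry `FunctionSpaces.EuclideanSpace.complexify`, and the real part is the accepted
bundled map `FunctionSpaces.EuclideanSpace.realPart : ℂ^ι →L[ℝ] ℝ^ι` (`TorusTrigPoly.lean`; same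
underlying function as `Literature.Analysis.FluidPDE.realPart`, by `rfl`). Mathlib's
Fourier-analytic lemmas see `ℂ^ι` as a real space through `NormedSpace.complexToReal`, whereas a
continuous `ℝ`-linear map out of `EuclideanSpace ℂ ι` elaborates against the componentwise real
structure `PiLp.normedSpace`; the two are definitionally equal and the unifier identifies them as
long as the linear map is a variable, which is why the assembly lemma is stated for a general
`L`.

## References

* T. Tao, *Finite time blowup for an averaged three-dimensional Navier–Stokes equation*,
  J. Amer. Math. Soc. 29 (2016), 601–674 (arXiv:1402.0290), §1.1.
* E. M. Stein, G. Weiss, *Introduction to Fourier Analysis on Euclidean Spaces*, PUP 1971,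
  Ch. I, Thm. 2.3 (Plancherel).
-/

noncomputable section

open MeasureTheory TopologicalSpace Set Function Filter Topology FourierTransform VectorFourier
open scoped InnerProductSpace RealInnerProductSpace ENNReal NNReal ContDiff SchwartzMap

namespace Literature.Analysis.FluidPDE

variable {ι : Type*} [Fintype ι]

namespace ContDiffEuler

/-! ### Schwartz inputs -/

/-- The symmetrised convective term `(u·∇)v + (v·∇)u` of two Schwartz fields is a Schwartz field
(product of a Schwartz field with the derivative of a Schwartz field). [folklore] -/
theorem isSchwartzField_convect_add {u v : EuclideanSpace ℝ ι → EuclideanSpace ℝ ι}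
    (hu : IsSchwartzField u) (hv : IsSchwartzField v) :
    IsSchwartzField fun x => convect u v x + convect v u x := by
  obtain ⟨U, rfl⟩ := hu
  obtain ⟨V, rfl⟩ := hv
  refine ⟨SchwartzMap.pairing
      (ContinuousLinearMap.id ℝ (EuclideanSpace ℝ ι →L[ℝ] EuclideanSpace ℝ ι))
      (SchwartzMap.fderivCLM ℝ (EuclideanSpace ℝ ι) (EuclideanSpace ℝ ι) V) U +
    SchwartzMap.pairing
      (ContinuousLinearMap.id ℝ (EuclideanSpace ℝ ι →L[ℝ] EuclideanSpace ℝ ι))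
      (SchwartzMap.fderivCLM ℝ (EuclideanSpace ℝ ι) (EuclideanSpace ℝ ι) U) V, ?_⟩
  funext x
  rfl

/-! ### Rapidly decreasing functions on the Fourier side -/

section Decay

variable {F : Type*} [NormedAddCommGroup F]

/-- A measurable function with `sup ‖ξ‖ᵏ ‖G ξ‖ < ∞` for all `k` has all moments integrable
(Mathlib `integrable_of_le_of_pow_mul_le`). [folklore] -/
theorem integrable_pow_mul_norm_of_decay {G : EuclideanSpace ℝ ι → F}
    (hGm : AEStronglyMeasurable G volume) (hG : ∀ k : ℕ, ∃ C, ∀ ξ, ‖ξ‖ ^ k * ‖G ξ‖ ≤ C)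
    (n : ℕ) : Integrable (fun ξ => ‖ξ‖ ^ n * ‖G ξ‖) (volume : Measure (EuclideanSpace ℝ ι)) := by
  obtain ⟨C₀, hC₀⟩ := hG 0
  obtain ⟨C, hC⟩ := hG (n + (volume : Measure (EuclideanSpace ℝ ι)).integrablePower)
  exact integrable_of_le_of_pow_mul_le (fun ξ => by simpa using hC₀ ξ) hC hGm

/-- Such a function is integrable. [folklore] -/
theorem integrable_of_decay {G : EuclideanSpace ℝ ι → F} (hGm : AEStronglyMeasurable G volume)
    (hG : ∀ k : ℕ, ∃ C, ∀ ξ, ‖ξ‖ ^ k * ‖G ξ‖ ≤ C) :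
    Integrable G (volume : Measure (EuclideanSpace ℝ ι)) := by
  have h := integrable_pow_mul_norm_of_decay hGm hG 0
  simp only [pow_zero, one_mul] at h
  exact (integrable_norm_iff hGm).1 h

/-- Such a function is square integrable (`‖G‖² ≤ (sup ‖G‖) ‖G‖`). [folklore] -/
theorem memLp_two_of_decay [NormedSpace ℝ F] {G : EuclideanSpace ℝ ι → F}
    (hGm : AEStronglyMeasurable G volume) (hG : ∀ k : ℕ, ∃ C, ∀ ξ, ‖ξ‖ ^ k * ‖G ξ‖ ≤ C) :
    MemLp G 2 (volume : Measure (EuclideanSpace ℝ ι)) := by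
  obtain ⟨C₀, hC₀⟩ := hG 0
  have hb : ∀ ξ, ‖G ξ‖ ≤ C₀ := fun ξ => by simpa using hC₀ ξ
  have hi := integrable_of_decay hGm hG
  refine (memLp_two_iff_integrable_sq_norm hGm).2 ?_
  refine (hi.norm.const_mul C₀).mono' (hGm.norm.pow 2) (ae_of_all _ fun ξ => ?_)
  rw [Real.norm_of_nonneg (sq_nonneg _), sq]
  exact mul_le_mul_of_nonneg_right (hb ξ) (norm_nonneg _)

end Decay

/-! ### Operator norm of a multilinear map on `ℝ^ι` versus its values on basis tuples -/

section Multilinear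

variable [DecidableEq ι] {F : Type*} [NormedAddCommGroup F] [NormedSpace ℝ F]

/-- Expansion of a multilinear map on `ℝ^ι` along the standard basis:
`A(v) = ∑_α (∏ⱼ v_j(α_j)) • A(e_{α 0}, …, e_{α (n-1)})`. [folklore] -/
theorem continuousMultilinearMap_apply_eq_sum_single {n : ℕ}
    (A : EuclideanSpace ℝ ι [×n]→L[ℝ] F) (v : Fin n → EuclideanSpace ℝ ι) :
    A v = ∑ α : Fin n → ι, (∏ j, v j (α j)) • A fun j => EuclideanSpace.single (α j) (1 : ℝ) := by
  have hv : v = fun j => ∑ l, v j l • (EuclideanSpace.single l (1 : ℝ) : EuclideanSpace ℝ ι) := by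
    funext j
    conv_lhs => rw [← (EuclideanSpace.basisFun ι ℝ).sum_repr (v j)]
    simp [EuclideanSpace.basisFun_apply]
  conv_lhs => rw [hv]
  rw [A.map_sum]
  refine Finset.sum_congr rfl fun α _ => ?_
  rw [A.map_smul_univ]

/-- **Operator norm versus basis values**: `‖A‖ ≤ ∑_α ‖A(e_α)‖` for a continuous multilinear map
on `ℝ^ι`. [folklore] -/
theorem norm_continuousMultilinearMap_le_sum_single {n : ℕ}
    (A : EuclideanSpace ℝ ι [×n]→L[ℝ] F) :
    ‖A‖ ≤ ∑ α : Fin n → ι, ‖A fun j => EuclideanSpace.single (α j) (1 : ℝ)‖ := by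
  refine A.opNorm_le_bound (Finset.sum_nonneg fun _ _ => norm_nonneg _) fun v => ?_
  rw [continuousMultilinearMap_apply_eq_sum_single, Finset.sum_mul]
  refine (norm_sum_le _ _).trans (Finset.sum_le_sum fun α _ => ?_)
  rw [norm_smul, mul_comm]
  refine mul_le_mul_of_nonneg_left ?_ (norm_nonneg _)
  rw [norm_prod]
  exact Finset.prod_le_prod (fun j _ => norm_nonneg _) fun j _ => PiLp.norm_apply_le (v j) (α j)

end Multilinear

/-! ### Fourier integrals of rapidly decreasing functions: smooth with `L²` derivatives -/

section FourierSide

variable {F : Type*} [NormedAddCommGroup F] [InnerProductSpace ℂ F] [CompleteSpace F]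

/-- For measurable `G` with `sup ‖ξ‖ᵏ‖G ξ‖ < ∞` for all `k`, the Fourier integral `𝓕 G` is
smooth and every derivative `Dⁿ 𝓕 G` is square integrable: `Dⁿ 𝓕 G` is the Fourier integral of
`(-2πi)ⁿ (ξ·)ⁿ G` (Mathlib `Real.iteratedFDeriv_fourier`), its values on basis tuples are
Fourier integrals of `L¹ ∩ L²` functions (Plancherel, Stein–Weiss 1971, Ch. I, Thm. 2.3), and the
operator norm is dominated by the sum of their norms. [folklore] -/
theorem contDiff_fourier_and_memLp_iteratedFDeriv_of_decay {G : EuclideanSpace ℝ ι → F}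
    (hGm : AEStronglyMeasurable G volume) (hG : ∀ k : ℕ, ∃ C, ∀ ξ, ‖ξ‖ ^ k * ‖G ξ‖ ≤ C) :
    ContDiff ℝ ∞ (𝓕 G) ∧
      ∀ n : ℕ, MemLp (iteratedFDeriv ℝ n (𝓕 G)) 2 (volume : Measure (EuclideanSpace ℝ ι)) := by
  classical
  have hint : ∀ k : ℕ,
      Integrable (fun ξ => ‖ξ‖ ^ k * ‖G ξ‖) (volume : Measure (EuclideanSpace ℝ ι)) :=
    integrable_pow_mul_norm_of_decay hGm hG
  have hsmooth : ContDiff ℝ ∞ (𝓕 G) := Real.contDiff_fourier (N := (⊤ : ℕ∞)) fun k _ => hint k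
  refine ⟨hsmooth, fun n => ?_⟩
  -- the functions whose Fourier integrals are the basis values of `Dⁿ 𝓕 G`
  let Gα : (Fin n → ι) → EuclideanSpace ℝ ι → F := fun α ξ =>
    fourierPowSMulRight (innerSL ℝ) G ξ n fun j => EuclideanSpace.single (α j) (1 : ℝ)
  have hGαm : ∀ α, AEStronglyMeasurable (Gα α) volume := fun α =>
    (ContinuousMultilinearMap.apply ℝ (fun _ : Fin n => EuclideanSpace ℝ ι) F fun j =>
        EuclideanSpace.single (α j) (1 : ℝ)).continuous.comp_aestronglyMeasurable
      (hGm.fourierPowSMulRight (innerSL ℝ) n)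
  have h2π : (2 * Real.pi * ‖innerSL ℝ (E := EuclideanSpace ℝ ι)‖) ^ n ≤ (2 * Real.pi) ^ n :=
    pow_le_pow_left₀ (by positivity)
      (mul_le_of_le_one_right (by positivity) (norm_innerSL_le ℝ)) n
  have hGαd : ∀ α, ∀ k : ℕ, ∃ C, ∀ ξ, ‖ξ‖ ^ k * ‖Gα α ξ‖ ≤ C := by
    intro α k
    obtain ⟨C, hC⟩ := hG (k + n)
    refine ⟨(2 * Real.pi) ^ n * C, fun ξ => ?_⟩
    have h1 : ‖Gα α ξ‖ ≤ (2 * Real.pi) ^ n * ‖ξ‖ ^ n * ‖G ξ‖ := by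
      refine (ContinuousMultilinearMap.le_opNorm _ _).trans ?_
      simp only [PiLp.norm_single, norm_one, Finset.prod_const_one, mul_one]
      refine (norm_fourierPowSMulRight_le (innerSL ℝ) G ξ n).trans ?_
      exact mul_le_mul_of_nonneg_right (mul_le_mul_of_nonneg_right h2π (by positivity))
        (norm_nonneg _)
    calc ‖ξ‖ ^ k * ‖Gα α ξ‖ ≤ ‖ξ‖ ^ k * ((2 * Real.pi) ^ n * ‖ξ‖ ^ n * ‖G ξ‖) := by gcongr
      _ = (2 * Real.pi) ^ n * (‖ξ‖ ^ (k + n) * ‖G ξ‖) := by ring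
      _ ≤ (2 * Real.pi) ^ n * C := by gcongr; exact hC ξ
  -- Plancherel for each `Gα`
  have hL2 : ∀ α, MemLp (𝓕 (Gα α)) 2 (volume : Measure (EuclideanSpace ℝ ι)) := fun α =>
    FunctionSpaces.memLp_two_fourierIntegral (integrable_of_decay (hGαm α) (hGαd α))
      (memLp_two_of_decay (hGαm α) (hGαd α))
  -- the basis values of `Dⁿ 𝓕 G`
  have hD : iteratedFDeriv ℝ n (𝓕 G) = 𝓕 fun ξ => fourierPowSMulRight (innerSL ℝ) G ξ n :=
    Real.iteratedFDeriv_fourier (N := (⊤ : ℕ∞)) (fun k _ => hint k) hGm le_top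
  have hDα : ∀ α x,
      iteratedFDeriv ℝ n (𝓕 G) x (fun j => EuclideanSpace.single (α j) (1 : ℝ)) =
        𝓕 (Gα α) x := by
    intro α x
    rw [hD, Real.fourier_continuousMultilinearMap_apply
      (integrable_fourierPowSMulRight (innerSL ℝ) (hint n) hGm)]
  -- domination and conclusion
  have hbound : ∀ x, ‖iteratedFDeriv ℝ n (𝓕 G) x‖ ≤ ∑ α : Fin n → ι, ‖𝓕 (Gα α) x‖ :=
    fun x => by
      refine (norm_continuousMultilinearMap_le_sum_single _).trans (le_of_eq ?_)
      exact Finset.sum_congr rfl fun α _ => by rw [hDα α x]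
  have hsum : MemLp (fun x => ∑ α : Fin n → ι, ‖𝓕 (Gα α) x‖) 2
      (volume : Measure (EuclideanSpace ℝ ι)) :=
    memLp_finsetSum _ fun α _ => (hL2 α).norm
  refine hsum.of_le ?_ (ae_of_all _ fun x => ?_)
  · exact (hsmooth.continuous_iteratedFDeriv (by exact_mod_cast le_top)).aestronglyMeasurable
  · rw [Real.norm_of_nonneg (Finset.sum_nonneg fun _ _ => norm_nonneg _)]
    exact hbound x

end FourierSide

/-! ### The assembly step -/

/-- Assembly step: a field of the form `c • (L ∘ 𝓕 G)` with `L : ℂ^ι →L[ℝ] ℝ^ι` and `G`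
measurable and rapidly decreasing is smooth with all derivatives in `L²` (used with the accepted
bundled real-part map `FunctionSpaces.EuclideanSpace.realPart`; stated for a general `L`, see the
module docstring). [folklore] -/
theorem contDiff_and_memLp_of_eq_smul_comp_fourier
    (L : EuclideanSpace ℂ ι →L[ℝ] EuclideanSpace ℝ ι)
    {B : EuclideanSpace ℝ ι → EuclideanSpace ℝ ι} {G : EuclideanSpace ℝ ι → EuclideanSpace ℂ ι}
    {c : ℝ} (hB : B = c • (⇑L ∘ (𝓕 G : EuclideanSpace ℝ ι → EuclideanSpace ℂ ι)))
    (hGm : AEStronglyMeasurable G volume) (hG : ∀ k : ℕ, ∃ C, ∀ ξ, ‖ξ‖ ^ k * ‖G ξ‖ ≤ C) :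
    ContDiff ℝ ∞ B ∧
      ∀ n : ℕ, MemLp (iteratedFDeriv ℝ n B) 2 (volume : Measure (EuclideanSpace ℝ ι)) := by
  subst hB
  obtain ⟨hsmooth, hL2⟩ := contDiff_fourier_and_memLp_iteratedFDeriv_of_decay hGm hG
  have hcomp : ContDiff ℝ ∞ (⇑L ∘ (𝓕 G : EuclideanSpace ℝ ι → EuclideanSpace ℂ ι)) :=
    L.contDiff.comp hsmooth
  have hsmoothB : ContDiff ℝ ∞ (c • (⇑L ∘ (𝓕 G : EuclideanSpace ℝ ι → EuclideanSpace ℂ ι))) :=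
    hcomp.const_smul c
  refine ⟨hsmoothB, fun n => ?_⟩
  refine (hL2 n).of_le_mul (c := ‖c‖ * ‖L‖)
    (hsmoothB.continuous_iteratedFDeriv (by exact_mod_cast le_top)).aestronglyMeasurable
    (ae_of_all _ fun x => ?_)
  rw [iteratedFDeriv_const_smul_apply (hcomp.contDiffAt.of_le (by exact_mod_cast le_top)),
    norm_smul, mul_assoc]
  gcongr
  exact L.norm_iteratedFDeriv_comp_left hsmooth.contDiffAt (by exact_mod_cast le_top)

/-! ### The Fourier side of `P w` for Schwartz `w` -/

/-- The Fourier transform `û = fourierVec u` of a Schwartz field is (the coercion of) a Schwartz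
map into `ℂ^ι` (Mathlib: the Fourier transform preserves the Schwartz class). [folklore] -/
theorem exists_schwartzMap_coe_eq_fourierVec {w : EuclideanSpace ℝ ι → EuclideanSpace ℝ ι}
    (hw : IsSchwartzField w) :
    ∃ Ŵ : 𝓢(EuclideanSpace ℝ ι, EuclideanSpace ℂ ι), fourierVec w = ⇑Ŵ := by
  obtain ⟨W, rfl⟩ := hw
  refine ⟨𝓕 (SchwartzMap.postcompCLM (𝕜 := ℝ)
    (FunctionSpaces.EuclideanSpace.complexify (ι := ι)).toContinuousLinearMap W), ?_⟩
  rw [SchwartzMap.fourier_coe]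
  rfl

/-- Rapid decay of the reflected Fourier-side integrand `ξ ↦ P̂(-ξ) Ŵ(-ξ)` of `P w` for a
Schwartz `Ŵ`: `‖ξ‖ᵏ ‖P̂(-ξ) Ŵ(-ξ)‖ ≤ 2 p_{k,0}(Ŵ)`, from the bound `‖P̂(ξ) c‖ ≤ ‖c‖ + ‖c‖`
(Cauchy–Schwarz for `ξ · c`) and the Schwartz seminorm `p_{k,0}`. [folklore] -/
theorem decay_leraySymbolC_schwartz (Ŵ : 𝓢(EuclideanSpace ℝ ι, EuclideanSpace ℂ ι)) (k : ℕ) :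
    ∃ C, ∀ ξ : EuclideanSpace ℝ ι, ‖ξ‖ ^ k * ‖leraySymbolC (-ξ) (Ŵ (-ξ))‖ ≤ C := by
  -- `‖P̂(η) c‖ ≤ 2‖c‖`
  have hP : ∀ (η : EuclideanSpace ℝ ι) (c : EuclideanSpace ℂ ι),
      ‖leraySymbolC η c‖ ≤ 2 * ‖c‖ := by
    intro η c
    have hdot : ‖∑ i, (η i : ℂ) * c i‖ ≤ ‖η‖ * ‖c‖ := by
      have h : ∑ i, (η i : ℂ) * c i = ⟪FunctionSpaces.EuclideanSpace.complexify η, c⟫_ℂ := by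
        simp [PiLp.inner_apply, mul_comm]
      rw [h, ← FunctionSpaces.EuclideanSpace.norm_complexify η]
      exact norm_inner_le_norm _ _
    have hproj : ‖((∑ i, (η i : ℂ) * c i) / ((‖η‖ ^ 2 : ℝ) : ℂ)) •
        FunctionSpaces.EuclideanSpace.complexify η‖ ≤ ‖c‖ := by
      rcases eq_or_ne η 0 with rfl | hη
      · simp
      · have hη' : 0 < ‖η‖ := norm_pos_iff.mpr hη
        rw [norm_smul, norm_div, FunctionSpaces.EuclideanSpace.norm_complexify,
          Complex.norm_real, Real.norm_of_nonneg (by positivity)]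
        calc ‖∑ i, (η i : ℂ) * c i‖ / ‖η‖ ^ 2 * ‖η‖ = ‖∑ i, (η i : ℂ) * c i‖ / ‖η‖ := by
              field_simp
          _ ≤ ‖η‖ * ‖c‖ / ‖η‖ := by gcongr
          _ = ‖c‖ := by field_simp
    calc ‖leraySymbolC η c‖ ≤ ‖c‖ + ‖((∑ i, (η i : ℂ) * c i) / ((‖η‖ ^ 2 : ℝ) : ℂ)) •
          FunctionSpaces.EuclideanSpace.complexify η‖ := norm_sub_le _ _
      _ ≤ ‖c‖ + ‖c‖ := by gcongr
      _ = 2 * ‖c‖ := by ring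
  refine ⟨2 * SchwartzMap.seminorm ℝ k 0 Ŵ, fun ξ => ?_⟩
  calc ‖ξ‖ ^ k * ‖leraySymbolC (-ξ) (Ŵ (-ξ))‖ ≤ ‖ξ‖ ^ k * (2 * ‖Ŵ (-ξ)‖) := by
        gcongr
        exact hP _ _
    _ = 2 * (‖-ξ‖ ^ k * ‖Ŵ (-ξ)‖) := by rw [norm_neg]; ring
    _ ≤ 2 * SchwartzMap.seminorm ℝ k 0 Ŵ := by
        gcongr
        exact SchwartzMap.norm_pow_mul_le_seminorm ℝ Ŵ k (-ξ)

/-- Measurability of the reflected Fourier-side integrand `ξ ↦ P̂(-ξ) Ŵ(-ξ)` (the symbol is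
discontinuous only at `ξ = 0`, where Lean's `x / 0 = 0` makes it the identity). [folklore] -/
theorem aestronglyMeasurable_leraySymbolC_schwartz
    (Ŵ : 𝓢(EuclideanSpace ℝ ι, EuclideanSpace ℂ ι)) :
    AEStronglyMeasurable (fun ξ : EuclideanSpace ℝ ι => leraySymbolC (-ξ) (Ŵ (-ξ))) volume := by
  suffices h : Measurable fun ξ : EuclideanSpace ℝ ι => leraySymbolC ξ (Ŵ ξ) from
    (h.comp measurable_neg).aestronglyMeasurable
  unfold leraySymbolC
  have h1 : Continuous fun ξ : EuclideanSpace ℝ ι => ∑ i, (ξ i : ℂ) * Ŵ ξ i := by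
    refine continuous_finsetSum _ fun i _ => ?_
    fun_prop
  have h2 : Continuous fun ξ : EuclideanSpace ℝ ι => ((‖ξ‖ ^ 2 : ℝ) : ℂ) := by fun_prop
  refine Ŵ.continuous.measurable.sub (Measurable.smul (h1.measurable.div h2.measurable) ?_)
  exact FunctionSpaces.EuclideanSpace.continuous_complexify.measurable

end ContDiffEuler

open ContDiffEuler in
/-- **Discharge of `contDiff_eulerBilinear`** (Tao 2016, §1.1, display after (1.8): `B(u,v)`
takes values in `L²`, and — for Schwartz inputs — is smooth with all derivatives in `L²`;
folklore regularity of the Leray-projected convective term: `P` is an `L²`-bounded Fourier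
multiplier commuting with derivatives and `(u·∇)v + (v·∇)u` is Schwartz).
[cite: Tao2016, §1.1, display after (1.8)] -/
theorem contDiff_eulerBilinear_holds : contDiff_eulerBilinear (ι := ι) := by
  intro u v hu hv
  obtain ⟨Ŵ, hŴ⟩ := exists_schwartzMap_coe_eq_fourierVec (isSchwartzField_convect_add hu hv)
  refine contDiff_and_memLp_of_eq_smul_comp_fourier FunctionSpaces.EuclideanSpace.realPart
    (c := -(2 : ℝ)⁻¹) ?_ (aestronglyMeasurable_leraySymbolC_schwartz Ŵ)
    (decay_leraySymbolC_schwartz Ŵ)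
  -- `P w = Re 𝓕⁻ (P̂ ŵ) = Re 𝓕 (ξ ↦ P̂(-ξ) ŵ(-ξ))`; the accepted bundled real part
  -- `FunctionSpaces.EuclideanSpace.realPart` has the same underlying function as `realPart`
  have hP : lerayProjFun (fun x => convect u v x + convect v u x) =
      ⇑(FunctionSpaces.EuclideanSpace.realPart (ι := ι)) ∘
        𝓕 fun ξ : EuclideanSpace ℝ ι => leraySymbolC (-ξ) (Ŵ (-ξ)) := by
    funext x
    simp only [lerayProjFun, hŴ, Function.comp_apply]
    rw [Real.fourierInv_eq_fourier_comp_neg]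
    rfl
  unfold eulerBilinear
  rw [hP]

end Literature.Analysis.FluidPDE
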